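import Summits.QuantumFields.YangMills.Theorems.BalabanUVNodesN08AlphaEq324RowCumLetter
import Summits.QuantumFields.Balaban3D.Proofs.Thm2AC

/-!
# Route «BalabanUVNodes», Track-A DAG node N08 = [Balaban1985UV3] Thm 1 p. 257 ∕ Thm 2 p. 272 — THE (α)-SCHEMA CURRENCY MISMATCH #3 ON THE ROAD OF RECORD:
# the [B1] (3.24) row of the d = 3 lane's ABSOLUTELY-CONTINUOUS-AVERAGING (α) package `Balaban3D.Proofs.AlphaAC.StepAlphaAC` in its SOURCE-FAITHFUL output-sandwich
# shape `B1Sect3Statements.Eq324`, AT AN ARBITRARY CUMULANT LETTER, over a RANGE-HONEST auxiliary bundle — part 1 of 2 (part 2 = `…N08AlphaEq324RowACEnd`: the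
# residual leaves, Thm 2 for the AC tower, the END bundle and N08's slot of record)

Cell `pub-ymgap`, seat `pub-ymgap-dag-n08-w4` gen 3 (WIDTH SEAT 4∕4 on N08; CLAIM-1∕INTENT-1 INBOX l.28989).  `bears_on: R4∕N08`; `--supports stmt-QuantumFields-20542` (K1⁷,
helper).  One `Type`-structure, two `Prop`-structures, one `def`, theorems; sorry-free; standard axioms; the lane's `Balaban3D/Proofs/*AC` modules consumed BY NAME, untouched.

THE LOCATED POINT (the AC twin of dag-n08-d g7's mismatch #3, resolved by gens 0∕2 of this seat for the Haar-compatible lane `UVStability3DInputs.StepAlpha` in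
`…N08AlphaEq324Row*` ∕ `…RowCumLetter*`).  The road of record to N08's slot `Node00.PrintedUV3V N L` is dag-n08-w1 g3's (R4‴) (`…N08SlotOfRecordFromAlphaAC`, p605761, no
E6′); its (α) antecedent `AlphaAC.RunAlphaAC` carries the [Balaban1982Higgs1] (3.24) input VERBATIM from `StepAlpha` as the TILTED pair `h324a` (`|log μ(box h)| ≤ Ca·unit`)
+ `h324c` (`sup_{t∈[0,1]} |∂ₜ^{n̄+1} cgf_{χμ}(𝒱 h U)(t)| ≤ Cc·(n̄+1)!·unit`, `unit = (Lᵏg₀²)^{3+κ₀}|T₁^{(k)}|`) with the regularity rows `hμ hboxm hbox hVm hVB`, consumed ONLY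
through Taylor–Lagrange (`LeavesCumAC.…_stdAC` ← `Eq324Chi`) to produce the printed OUTPUT sandwich `Eq324 ⟨χe^{𝒱}⟩ (cum) n̄ (Ca+Cc) (Lᵏg₀²) (3+κ₀) |T₁^{(k)}|`.  The row's only
printed SOURCE — [BenfattoEtAl1978]'s lemma p. 152 via [B1] p. 616 (tree `B1Eq324BenfattoSect5BasicLemma.basicLemmaPrinted_holds`; the class editions of the dag-n08-b∕-c∕-d
road) — delivers exactly that sandwich at the FREE Gaussian moment-cumulant letter and nothing about tilted cgf-derivatives; so no sandwich supplier could plug into (R4‴).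
* §1 `cumulant58∕cumulantLower_series_stdAC_of_eq324_at` — rows C3∕C4 at `SeriesAC.TowerBaseAC.seriesPiecesAC` from ONE `Eq324` row at a letter `c` + G3D-02 + R-ACT + (25)
  (one application of `Run3Cumulant.cumulant58_of_graphRep23'` ∕ `Cumulant59.cumulantLower_torus`); `cumulant58∕cumulantLower_piecesAC_of_eq324_at` at `InputsAC.piecesAC`.
* §2 `AlphaDataLTAC` — `AlphaAC.AlphaDataAC` with G3D-07∕08 carried ONLY on the run's steps `k + 1 ≤ K`, no `Bv` (RANGE-HONEST like gen 0's `…RowRange.AlphaDataLT`: the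
  binder's `far_le` field is unsatisfiable at steps `g_k > e` for `r₀ = 2` records — dag-n08-d g6's `…AlphaFarCurrency.isEmpty_alphaData_of_r₀_eq_two`, a tower-independent
  mechanism; the run reads `Λc∕N45` on `k < K` only: `Bound46AC.abs_pint_le_stdAC`, `AlphaAdaptersAC.decomp35_61_piecesAC`); `restrictLTAC`.
* §3 `StepAlphaEq324CoreLTAtAC k hk` (`StepAlphaAC k` minus `hμ hboxm hbox hVm hVB h324a h324c`, plus the printed row `h324` at the letter `c k`, G3D-02 `hG` about
  `Σ_{n≤n̄} c k h U n∕n!`, `hPYZ` at `𝔄.Λc k hk`); `RunAlphaEq324CoreLTAtAC`.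
* §4 `stepCoreLTAtAC_of_stepAlphaAC`, ★ `coreLTAtAC_cum_of_runAlphaAC` — THE AC CLAUSE AS LANDED IMPLIES THE EDITION at the lane's χ-letter `(𝔖 ·).cum` (Taylor–Lagrange once;
  no converse; the letter congruence `stepCoreLTAtAC_congr` sits in part 2).  The supplier socket at the letter is gen 2's `…RowCumLetter.h324RowAt_of_abs_log_le` VERBATIM (same `𝔖`-type; the `h324` field is its
  conclusion character for character), so `…RowCumLetterModel.h324RowAt_freeLetter_of_map` plugs a presented class∕[2] supplier into THIS clause.
HONEST SCOPE ∕ A6.  Hypothesis-shape bookkeeping: the edition is IMPLIED by `RunAlphaAC` (§4), so every inhabitant of (R4‴)'s antecedent inhabits it; nothing decided about the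
TRUTH of the (3.24) row for Bałaban's data (N08's object gap; the IDENT of B10's step block with a class model is class II); not a defect of any landed module.  Count-neutral;
N08 NOT discharged; one finite 𝕋⁴ programme at fixed ε, d = 3 tori of [B10] inside the record, Bałaban AS PRINTED; nothing about d = 4 continuum limits, OS axioms, a mass gap
or Clay — R4 closes the conditional finite-𝕋⁴ rung `BalabanLadder.UV` only.  References: [Balaban1985UV3] CMP 102 (1985) 255–275 — (23)–(25) p. 262, (58)–(59) p. 270, (63)
p. 272, (67)–(68) p. 273; [Balaban1982Higgs1] CMP 85 (1982) — (3.24) p. 616; [BenfattoEtAl1978] CMP 59 (1978) — Lemma p. 152, (2.7) p. 147.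
-/

noncomputable section

namespace Summit.QuantumFields.YangMills.Theorems.BalabanUVNodesN08AlphaEq324RowAC

open MeasureTheory Metric
open scoped BigOperators Nat Matrix.Norms.L2Operator
open Literature.MathematicalPhysics.QuantumFieldTheory.Balaban1983to89
open Literature.MathematicalPhysics.QuantumFieldTheory.Balaban1983to89.B10
open Literature.MathematicalPhysics.QuantumFieldTheory.Balaban1983to89.B10SectAGathering
open Literature.MathematicalPhysics.QuantumFieldTheory.Balaban1983to89.B10SectCExpansion (Bound44)
open Literature.MathematicalPhysics.QuantumFieldTheory.Balaban1983to89.B12TreeDecay (kappa₀ K₀)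
open Literature.MathematicalPhysics.QuantumFieldTheory.Balaban1983to89.TreeLengthTorus (tsys tcubeSys)
open Literature.MathematicalPhysics.QuantumFieldTheory.Balaban1983to89.B1Sect3Statements (Eq324)
open Literature.MathematicalPhysics.QuantumFieldTheory.Balaban1985CMP102
open Literature.MathematicalPhysics.QuantumFieldTheory.Balaban1985CMP102.Setting
open Literature.MathematicalPhysics.QuantumFieldTheory.Balaban1985CMP102.Theorems
open Literature.MathematicalPhysics.QuantumFieldTheory.Balaban1985CMP102.Binders
  (ChartAnalyticityAsCited FarTermsDecayAsCited Norm35StepAsCited LogZTExtensiveAsCited LogZLocalizedAsCited GraphTerms GraphRep23AsCited)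
open Literature.MathematicalPhysics.QuantumFieldTheory.Balaban1985CMP102.BindersNewborn (NewbornTerms45AsCited)
open Summit.QuantumFields.Balaban3D.Carriers
open Summit.QuantumFields.Balaban3D.Proofs
open Summit.QuantumFields.Balaban3D.Proofs.ScalesArithmetic
open Summit.QuantumFields.Balaban3D.Proofs.Inputs
open Summit.QuantumFields.Balaban3D.Proofs.Primitives
open Summit.QuantumFields.Balaban3D.Proofs.Representation33 (jet26)
open Summit.QuantumFields.Balaban3D.Proofs.LiftBridge (liftCfg)
open Summit.QuantumFields.Balaban3D.Proofs.Run3SmallFactors (codeZ)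
open Summit.QuantumFields.Balaban3D.Proofs.GroupModelLieC (lieC)
open Summit.QuantumFields.Balaban3D.Proofs.UVStability3DInputs (lieChart adjAct hdet_adjAct)
open Summit.QuantumFields.Balaban3D.Proofs.TowerAC
open Summit.QuantumFields.Balaban3D.Proofs.SeriesAC
open Summit.QuantumFields.Balaban3D.Proofs.StandardAC
open Summit.QuantumFields.Balaban3D.Proofs.InputsAC
open Summit.QuantumFields.Balaban3D.Proofs.Bound55AC
open Summit.QuantumFields.Balaban3D.Proofs.AlphaAC
open B7Prop1Explicit (hol plaqWord)
open B7Prop1Local (pdevOn loK plaqHiK)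
open B7Prop2Explicit (avgIter)

variable {L : ℕ}

/-! ## §1 Rows C3∕C4 at the AC torus-block carrier and at the AC pieces from ONE `Eq324` row, at an arbitrary cumulant letter -/
section SeriesAt

variable {S : Scales L} {G : Type} [GaugeGroup G] [MeasurableSpace G] [HaarData G]
  {V : Type} [NormedAddCommGroup V] [NormedSpace ℂ V] {Nc : ℕ → ℕ} [∀ k, NeZero (Nc k)]

/-- The run-slot arithmetic shared by rows C3∕C4 (as in `LeavesCumAC.…_stdAC`): `0 < g_k`, `0 ≤ Rret`, and the large-domain booking `C·g_k·K₀·N³·e^{−Rret} ≤ C·K₀·e^{−R₁}·rem`.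
[cite: Balaban1985UV3, (59) p.270 (bookkeeping)] -/
theorem slots_stdAC (B : TowerBaseAC S G) (𝔖 : ∀ k, StepSeries S G V (Nc k) k) (Cp : ∀ k, PiecesParams S k) (k : ℕ) {C : ℝ} (hC : 0 ≤ C)
    (hk : k ≤ S.K) (hκ₀ : 0 < B.κ₀) {r₀ R₁ : ℝ} (hr₀ : 1 ≤ r₀) (hR₁ : 6 + 2 * B.κ₀ ≤ R₁)
    (hrem : (Cp k).rem = ((L : ℝ) ^ k * S.g0sq) ^ (3 + B.κ₀) * S.sites k) (hRret : B.Rret k = R₁ * B10.rFun r₀ (S.gk k))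
    (hblocks : ((𝔖 k).Nblk : ℝ) ^ 3 ≤ S.sites k) :
    0 < S.gk k ∧ 0 ≤ B.Rret k ∧ (C * S.gk k * K₀ (4 * 2 ^ 3) (2 * 3) * ((𝔖 k).Nblk : ℝ) ^ 3) * Real.exp (-B.Rret k) ≤
      (C * K₀ (4 * 2 ^ 3) (2 * 3) * Real.exp (-R₁)) * (Cp k).rem := by
  have hg : 0 < S.gk k := gk_pos S k
  have hg1 : S.gk k ≤ 1 := gk_le_one S S.gK_le_one k hk
  have hK₀ : 0 ≤ K₀ (4 * 2 ^ 3) (2 * 3) := (B12TreeDecay.K₀_pos _ _).le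
  refine ⟨hg, by rw [hRret]; exact mul_nonneg (by linarith) (VacuumAndBooking.rFun_nonneg r₀ (S.gk k) hg hg1), ?_⟩
  have h := largeLoc_le_normRem S (r₀ := r₀) (R₁ := R₁) (κ₀ := B.κ₀) (A := C * K₀ (4 * 2 ^ 3) (2 * 3))
    (vol := ((𝔖 k).Nblk : ℝ) ^ 3) k hk hr₀ (by linarith) (by linarith) (mul_nonneg hC hK₀) (by positivity) hblocks
  rw [hRret, hrem, ScalesArithmetic.norm_rem_eq]
  calc C * S.gk k * K₀ (4 * 2 ^ 3) (2 * 3) * ((𝔖 k).Nblk : ℝ) ^ 3 * Real.exp (-(R₁ * B10.rFun r₀ (S.gk k)))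
      = C * K₀ (4 * 2 ^ 3) (2 * 3) * S.gk k * ((𝔖 k).Nblk : ℝ) ^ 3 * Real.exp (-(R₁ * B10.rFun r₀ (S.gk k))) := by ring
    _ ≤ C * K₀ (4 * 2 ^ 3) (2 * 3) * Real.exp (-R₁) * ((S.gk k ^ 2) ^ (3 + B.κ₀) * S.sites k) := h

/-- **Row C3 `Cumulant58` AT `TowerBaseAC.seriesPiecesAC` FROM ONE `Eq324` ROW, AT AN ARBITRARY CUMULANT LETTER `c`** — the lane's `LeavesCumAC.cumulant58_series_stdAC`
with the tilted (3.24) inputs (a) `h324a`, (c) `h324c` and the box∕potential regularity rows replaced by ONE row of the printed shape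
`h324 : Eq324 (∫_{box h} e^{𝒱 h U} dμ) (c h U) n̄ C₂ (Lᵏg₀²) (3+κ₀) |T₁^{(k)}|`, read together with G3D-02 `hG` at the same letter, R-ACT `hact` and (25) for `act`;
run slots as there.  Constants OUT: `Cz = C·K₀(32,6)`, `C₁ = 0 + C·K₀(32,6)·e^{−R₁} + C₂`.  One application of `Run3Cumulant.cumulant58_of_graphRep23'` (AC twin of
gen 2's `…RowCumLetter.cumulant58_series_std_of_eq324_at`). [cite: Balaban1985UV3, (24) p.262 + (58)–(59) p.270; Balaban1982Higgs1, (3.24) p.616] -/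
theorem cumulant58_series_stdAC_of_eq324_at (B : TowerBaseAC S G) (𝔖 : ∀ k, StepSeries S G V (Nc k) k) (Cp : ∀ k, PiecesParams S k) (k : ℕ)
    [DecidableEq (tsys 3 (𝔖 k).Nblk).Dom] {κ C : ℝ}
    (hκ : kappa₀ (4 * 2 ^ 3) (2 * 3) + 1 ≤ κ) (hC : 0 ≤ C) {C₂₃ c₂₃ M₁ δ₀ : ℝ}
    (hact : ∀ h X U, ((𝔖 k).Gt h).activities.act X U = (𝔖 k).act h X U) {nbar : ℕ} {C₂ : ℝ}
    (c : Hist S.P (k + 1) → GaugeField S.P (k + 1) G → ℕ → ℝ)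
    (h324 : ∀ h (U : GaugeField S.P (k + 1) G),
      Eq324 (∫ ω in (𝔖 k).box h, Real.exp ((𝔖 k).𝒱 h U ω) ∂(𝔖 k).μ) (c h U) nbar C₂ ((L : ℝ) ^ k * S.g0sq) (3 + B.κ₀) (S.sites k))
    (hC₂ : 0 ≤ C₂) (hk : k ≤ S.K) (hκ₀ : 0 < B.κ₀) {r₀ R₁ : ℝ} (hr₀ : 1 ≤ r₀) (hR₁ : 6 + 2 * B.κ₀ ≤ R₁)
    (hrem : (Cp k).rem = ((L : ℝ) ^ k * S.g0sq) ^ (3 + B.κ₀) * S.sites k)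
    (hRret : B.Rret k = R₁ * B10.rFun r₀ (S.gk k))
    (hblocks : ((𝔖 k).Nblk : ℝ) ^ 3 ≤ S.sites k)
    (hG : ∀ h, GraphRep23AsCited ((𝔖 k).Gt h) (fun U => ∑ n ∈ Finset.Icc 1 nbar, c h U n / (n ! : ℝ)) C₂₃ c₂₃ M₁ δ₀)
    (h25 : ∀ h, B10.Bound25Printed
      ⟨(tsys 3 (𝔖 k).Nblk).Dom, GaugeField S.P (k + 1) G, (tsys 3 (𝔖 k).Nblk).dj, (𝔖 k).act h⟩ (S.gk k) κ C) :
    Cumulant58 (B.seriesPiecesAC 𝔖 Cp k) (C * K₀ (4 * 2 ^ 3) (2 * 3)) (0 + C * K₀ (4 * 2 ^ 3) (2 * 3) * Real.exp (-R₁) + C₂) := by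
  have hZ : ∀ h, (((Finset.univ : Finset (tcubeSys 3 (𝔖 k).Nblk).Cube) \ ΩblkOf (P := S.P) B.M₁ B.Rcol (Nc k) h).card : ℝ) ≤ (B.seriesPiecesAC 𝔖 Cp k).Zvol h :=
    fun h => by show _ ≤ ((ZVol B.M₁ B.Rcol (k + 1) h k : ℕ) : ℝ); exact_mod_cast card_compl_ΩblkOf_le_ZVol (P := S.P) B.M₁ B.Rcol (Nc k) h
  obtain ⟨hg, hR, hlarge⟩ := slots_stdAC B 𝔖 Cp k hC hk hκ₀ hr₀ hR₁ hrem hRret hblocks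
  have hPprU : ∀ (h : Hist S.P (k + 1)) (U : GaugeField S.P (k + 1) G), (B.seriesPiecesAC 𝔖 Cp k).PprU h U = ∑ X ∈ Finset.univ.filter
      (fun X : (tsys 3 (𝔖 k).Nblk).Dom => (tcubeSys 3 (𝔖 k).Nblk).cubes X ⊆ ΩblkOf (P := S.P) B.M₁ B.Rcol (Nc k) h ∧ (tsys 3 (𝔖 k).Nblk).dj X < B.Rret k),
        (𝔖 k).act h X U := fun _ _ => rfl
  exact cumulant58_of_graphRep23' (𝔖 k).Nblk (B.seriesPiecesAC 𝔖 Cp k) hκ (𝔖 k).Gt (𝔖 k).act hact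
    (fun h U => ∫ ω in (𝔖 k).box h, Real.exp ((𝔖 k).𝒱 h U ω) ∂(𝔖 k).μ) c
    (fun h => ΩblkOf (P := S.P) B.M₁ B.Rcol (Nc k) h) hG h25
    (fun h U => by rw [zero_mul, add_zero]; exact le_of_eq rfl) h324 hC₂ (le_of_eq hrem.symm) hR (mul_nonneg hC hg.le)
    (fun h U => by rw [hPprU h U, sum_filter_and_eq]) hZ hlarge

/-- **Row C4 `CumulantLower` AT `TowerBaseAC.seriesPiecesAC` FROM ONE `Eq324` ROW, AT AN ARBITRARY CUMULANT LETTER `c`** (lower direction at the trivial history;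
one application of the lane's `Cumulant59.cumulantLower_torus`, whose cumulant argument is free; AC twin of gen 2's `…RowCumLetter.cumulantLower_series_std_of_eq324_at`).
[cite: Balaban1985UV3, (37) p.265 + p.272 + (59) p.270; Balaban1982Higgs1, (3.24) p.616] -/
theorem cumulantLower_series_stdAC_of_eq324_at (B : TowerBaseAC S G) (𝔖 : ∀ k, StepSeries S G V (Nc k) k) (Cp : ∀ k, PiecesParams S k) (k : ℕ)
    [DecidableEq (tsys 3 (𝔖 k).Nblk).Dom] {κ C : ℝ}
    (hκ : kappa₀ (4 * 2 ^ 3) (2 * 3) + 1 ≤ κ) (hC : 0 ≤ C) {C₂₃ c₂₃ M₁ δ₀ : ℝ}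
    (hact : ∀ h X U, ((𝔖 k).Gt h).activities.act X U = (𝔖 k).act h X U) {nbar : ℕ} {C₂ : ℝ}
    (c : Hist S.P (k + 1) → GaugeField S.P (k + 1) G → ℕ → ℝ)
    (h324 : ∀ h (U : GaugeField S.P (k + 1) G),
      Eq324 (∫ ω in (𝔖 k).box h, Real.exp ((𝔖 k).𝒱 h U ω) ∂(𝔖 k).μ) (c h U) nbar C₂ ((L : ℝ) ^ k * S.g0sq) (3 + B.κ₀) (S.sites k))
    (hC₂ : 0 ≤ C₂) (hk : k ≤ S.K) (hκ₀ : 0 < B.κ₀) {r₀ R₁ : ℝ} (hr₀ : 1 ≤ r₀) (hR₁ : 6 + 2 * B.κ₀ ≤ R₁)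
    (hrem : (Cp k).rem = ((L : ℝ) ^ k * S.g0sq) ^ (3 + B.κ₀) * S.sites k)
    (hRret : B.Rret k = R₁ * B10.rFun r₀ (S.gk k))
    (hblocks : ((𝔖 k).Nblk : ℝ) ^ 3 ≤ S.sites k)
    (hG : ∀ h, GraphRep23AsCited ((𝔖 k).Gt h) (fun U => ∑ n ∈ Finset.Icc 1 nbar, c h U n / (n ! : ℝ)) C₂₃ c₂₃ M₁ δ₀)
    (h25 : ∀ h, B10.Bound25Printed
      ⟨(tsys 3 (𝔖 k).Nblk).Dom, GaugeField S.P (k + 1) G, (tsys 3 (𝔖 k).Nblk).dj, (𝔖 k).act h⟩ (S.gk k) κ C) :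
    CumulantLower (B.seriesPiecesAC 𝔖 Cp k) (0 + C * K₀ (4 * 2 ^ 3) (2 * 3) * Real.exp (-R₁) + C₂) := by
  have hZ : ∀ h, (((Finset.univ : Finset (tcubeSys 3 (𝔖 k).Nblk).Cube) \ ΩblkOf (P := S.P) B.M₁ B.Rcol (Nc k) h).card : ℝ) ≤ (B.seriesPiecesAC 𝔖 Cp k).Zvol h :=
    fun h => by show _ ≤ ((ZVol B.M₁ B.Rcol (k + 1) h k : ℕ) : ℝ); exact_mod_cast card_compl_ΩblkOf_le_ZVol (P := S.P) B.M₁ B.Rcol (Nc k) h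
  obtain ⟨hg, hR, hlarge⟩ := slots_stdAC B 𝔖 Cp k hC hk hκ₀ hr₀ hR₁ hrem hRret hblocks
  have hPprU : ∀ (h : Hist S.P (k + 1)) (U : GaugeField S.P (k + 1) G), (B.seriesPiecesAC 𝔖 Cp k).PprU h U = ∑ X ∈ Finset.univ.filter
      (fun X : (tsys 3 (𝔖 k).Nblk).Dom => (tcubeSys 3 (𝔖 k).Nblk).cubes X ⊆ ΩblkOf (P := S.P) B.M₁ B.Rcol (Nc k) h ∧ (tsys 3 (𝔖 k).Nblk).dj X < B.Rret k),
        (𝔖 k).act h X U := fun _ _ => rfl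
  exact cumulantLower_torus (𝔖 k).Nblk (B.seriesPiecesAC 𝔖 Cp k) hκ
    (fun h U => ∫ ω in (𝔖 k).box h, Real.exp ((𝔖 k).𝒱 h U ω) ∂(𝔖 k).μ) c (𝔖 k).act
    (fun h => ΩblkOf (P := S.P) B.M₁ B.Rcol (Nc k) h)
    (fun U => by rw [zero_mul, sub_zero]; exact le_of_eq rfl) (fun U => h324 _ U) hC₂ (le_of_eq hrem.symm) hR (mul_nonneg hC hg.le) h25
    (fun h U => by rw [(hG h).cum_eq_sum_activities U]; exact Finset.sum_congr rfl fun X _ => hact h X U)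
    (fun h U => by rw [hPprU h U, sum_filter_and_eq]) hZ hlarge

end SeriesAt

section PiecesAt

variable (𝔎 : LaneConsts L) {S : Scales L} {G : Type} [GaugeGroup G] [MeasurableSpace G] [HaarData G]
  {V : Type} [NormedAddCommGroup V] [NormedSpace ℂ V]
  (X : ExternalInputsAC S G) (𝔖 : ∀ k, StepSeries S G V (nblkOf S 𝔎.carrier k) k) (k : ℕ)

open Classical in
/-- **Row C3 AT THE LANE'S AC PIECES `InputsAC.piecesAC` from ONE `Eq324` row, at an arbitrary cumulant letter `c`** — twin of `AlphaAdaptersAC.cumulant58_piecesAC`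
with `hμ hboxm hbox hVm hVB h324a h324c ↦ h324` (record constants `Cz`, `C₁`; `hC₁` read with `C₂` in place of `Ca + 0 + Cc`). [cite: Balaban1985UV3, (24) p.262 + (58)–(59) p.270] -/
theorem cumulant58_piecesAC_of_eq324_at (hk : k + 1 ≤ S.K) {κ C25 : ℝ}
    (hκ : kappa₀ (4 * 2 ^ 3) (2 * 3) + 1 ≤ κ) (hC25 : 0 ≤ C25) (hr₀ : 1 ≤ 𝔎.F.r₀) (hR₁ : 6 + 2 * 𝔎.F.κ₀ ≤ 𝔎.F.R₁)
    {C₂₃ c₂₃ M₁ δ₀ : ℝ} {nbar : ℕ} {C₂ : ℝ} (hC₂ : 0 ≤ C₂)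
    (hCz : 𝔎.sc.Cz = C25 * K₀ (4 * 2 ^ 3) (2 * 3))
    (hC₁ : 𝔎.sc.C₁ = 0 + C25 * K₀ (4 * 2 ^ 3) (2 * 3) * Real.exp (-𝔎.F.R₁) + C₂)
    (hact : ∀ h Y U, ((𝔖 k).Gt h).activities.act Y U = (𝔖 k).act h Y U)
    (c : Hist S.P (k + 1) → GaugeField S.P (k + 1) G → ℕ → ℝ)
    (h324 : ∀ h (U : GaugeField S.P (k + 1) G),
      Eq324 (∫ ω in (𝔖 k).box h, Real.exp ((𝔖 k).𝒱 h U ω) ∂(𝔖 k).μ) (c h U) nbar C₂ ((L : ℝ) ^ k * S.g0sq) (3 + 𝔎.F.κ₀) (S.sites k))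
    (hG : ∀ h, GraphRep23AsCited ((𝔖 k).Gt h) (fun U => ∑ n ∈ Finset.Icc 1 nbar, c h U n / (n ! : ℝ)) C₂₃ c₂₃ M₁ δ₀)
    (h25 : ∀ h, Bound25Printed ⟨(tsys 3 (𝔖 k).Nblk).Dom, GaugeField S.P (k + 1) G, (tsys 3 (𝔖 k).Nblk).dj, (𝔖 k).act h⟩
      (S.gk k) κ C25) :
    Cumulant58 (piecesAC 𝔎 X 𝔖 k) 𝔎.sc.Cz 𝔎.sc.C₁ := by
  rw [hCz, hC₁]
  exact cumulant58_series_stdAC_of_eq324_at (X.toTowerBase 𝔎.carrier) 𝔖 (piecesParamsOf S 𝔎.carrier) k hκ hC25 hact c h324 hC₂ (by omega)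
    𝔎.F.κ₀_pos hr₀ hR₁ (norm_rem_eq S 𝔎.F.κ₀ k).symm rfl (nblk_cube_le_sites 𝔎 k (by omega)) hG h25

open Classical in
/-- **Row C4 AT THE LANE'S AC PIECES from ONE `Eq324` row, at an arbitrary cumulant letter `c`** — twin of `AlphaAdaptersAC.cumulantLower_piecesAC`
(`hC₁'` read with `C₂` in place of `Ca + 0 + Cc`). [cite: Balaban1985UV3, (37) p.265 + p.272 + (59) p.270] -/
theorem cumulantLower_piecesAC_of_eq324_at (hk : k + 1 ≤ S.K) {κ C25 : ℝ}
    (hκ : kappa₀ (4 * 2 ^ 3) (2 * 3) + 1 ≤ κ) (hC25 : 0 ≤ C25) (hr₀ : 1 ≤ 𝔎.F.r₀) (hR₁ : 6 + 2 * 𝔎.F.κ₀ ≤ 𝔎.F.R₁)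
    {C₂₃ c₂₃ M₁ δ₀ : ℝ} {nbar : ℕ} {C₂ : ℝ} (hC₂ : 0 ≤ C₂)
    (hC₁' : 𝔎.sc.C₁' = 0 + C25 * K₀ (4 * 2 ^ 3) (2 * 3) * Real.exp (-𝔎.F.R₁) + C₂)
    (hact : ∀ h Y U, ((𝔖 k).Gt h).activities.act Y U = (𝔖 k).act h Y U)
    (c : Hist S.P (k + 1) → GaugeField S.P (k + 1) G → ℕ → ℝ)
    (h324 : ∀ h (U : GaugeField S.P (k + 1) G),
      Eq324 (∫ ω in (𝔖 k).box h, Real.exp ((𝔖 k).𝒱 h U ω) ∂(𝔖 k).μ) (c h U) nbar C₂ ((L : ℝ) ^ k * S.g0sq) (3 + 𝔎.F.κ₀) (S.sites k))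
    (hG : ∀ h, GraphRep23AsCited ((𝔖 k).Gt h) (fun U => ∑ n ∈ Finset.Icc 1 nbar, c h U n / (n ! : ℝ)) C₂₃ c₂₃ M₁ δ₀)
    (h25 : ∀ h, Bound25Printed ⟨(tsys 3 (𝔖 k).Nblk).Dom, GaugeField S.P (k + 1) G, (tsys 3 (𝔖 k).Nblk).dj, (𝔖 k).act h⟩
      (S.gk k) κ C25) :
    CumulantLower (piecesAC 𝔎 X 𝔖 k) 𝔎.sc.C₁' := by
  rw [hC₁']
  exact cumulantLower_series_stdAC_of_eq324_at (X.toTowerBase 𝔎.carrier) 𝔖 (piecesParamsOf S 𝔎.carrier) k hκ hC25 hact c h324 hC₂ (by omega)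
    𝔎.F.κ₀_pos hr₀ hR₁ (norm_rem_eq S 𝔎.F.κ₀ k).symm rfl (nblk_cube_le_sites 𝔎 k (by omega)) hG h25

end PiecesAt

/-! ## §2 The RANGE-HONEST auxiliary expansion data of the AC package -/
section Data

variable {S : Scales L} {G : Type} [GaugeGroup G] [MeasurableSpace G] [HaarData G] (𝔊 : GroupModel G) (𝔠 : AlphaConsts L 𝔊.N)
  (X : ExternalInputsAC S G) (𝔖 : ∀ k, StepSeries S G ↥(lieC 𝔊) (nblkOf S 𝔠.lane.carrier k) k)

/-- **RANGE-HONEST AUXILIARY EXPANSION DATA OF THE AC PACKAGE** — `AlphaAC.AlphaDataAC` with the GAP binders G3D-07 «(63) as cited» and G3D-08 carried ONLY at the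
run's steps `k + 1 ≤ K` (the only ones the run reads: `Bound46AC.abs_pint_le_stdAC`, `AlphaAdaptersAC.decomp35_61_piecesAC`), the interaction bound `cP` and the G3D-02
constants as there, and NO box bound `Bv` (idle in the source-faithful core currency).  DATA; nothing asserted. [cite: Balaban1985UV3, (23) p.262 + (45) p.267 + (63) p.272] -/
structure AlphaDataLTAC where
  /-- G3D-07 «(63) as cited» at step `k < K` -/
  Λc : ∀ k, k + 1 ≤ S.K → LogZLocalizedAsCited (towerOfAC 𝔠.lane X 𝔖) k (𝔖 k).E (adjAct 𝔊 (P := S.P) k) 𝔠.ρ 𝔠.r₀ 𝔠.Cfar 𝔠.C63 𝔠.κ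
    (piecesAC 𝔠.lane X 𝔖 k).logZU (piecesAC 𝔠.lane X 𝔖 k).logZ1 (𝔖 k).Bcfg
    (fun h => Finset.univ.filter fun Y : (tsys 3 (nblkOf S 𝔠.lane.carrier k)).Dom =>
      Y.1 ⊆ ΩblkOf 𝔠.lane.carrier.M₁ (rcolOf S 𝔠.lane.carrier) (nblkOf S 𝔠.lane.carrier k) h)
  /-- G3D-08 «(45) as cited» for the (61)-born pieces of `Λc k hk`, at step `k < K` -/
  N45 : ∀ k (hk : k + 1 ≤ S.K), NewbornTerms45AsCited (towerOfAC 𝔠.lane X 𝔖) k (𝔖 k).E (adjAct 𝔊 (P := S.P) k) 𝔠.ρ 𝔠.r₀ 𝔠.Cfar 𝔠.C63 𝔠.κ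
    (piecesAC 𝔠.lane X 𝔖 k).logZU (piecesAC 𝔠.lane X 𝔖 k).logZ1 (𝔖 k).Bcfg
    (fun h => Finset.univ.filter fun Y : (tsys 3 (nblkOf S 𝔠.lane.carrier k)).Dom =>
      Y.1 ⊆ ΩblkOf 𝔠.lane.carrier.M₁ (rcolOf S 𝔠.lane.carrier) (nblkOf S 𝔠.lane.carrier k) h) (Λc k hk) 𝔠.C45
  /-- upper bound of the interaction sum `Pint k` of (43), per step -/
  cP : ℕ → ℝ
  /-- G3D-02 constants of (23), per step -/
  C₂₃ : ℕ → ℝ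
  /-- G3D-02 constants of (23), per step -/
  c₂₃ : ℕ → ℝ
  /-- G3D-02 constants of (23), per step -/
  M₂₃ : ℕ → ℝ
  /-- G3D-02 constants of (23), per step -/
  δ₀ : ℕ → ℝ

variable {𝔊 𝔠 X 𝔖}

/-- **The AC package's bundle restricted to the run** (forget `Bv` and the binders beyond `K`). [cite: Balaban1985UV3, (63) p.272 (bookkeeping)] -/
def restrictLTAC (𝔄 : AlphaDataAC 𝔊 𝔠 X 𝔖) : AlphaDataLTAC 𝔊 𝔠 X 𝔖 where
  Λc k _ := 𝔄.Λc k
  N45 k _ := 𝔄.N45 k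
  cP := 𝔄.cP
  C₂₃ := 𝔄.C₂₃
  c₂₃ := 𝔄.c₂₃
  M₂₃ := 𝔄.M₂₃
  δ₀ := 𝔄.δ₀

end Data

/-! ## §3 The range-honest core (α)-AC step list and run clause AT A CUMULANT LETTER -/
section Alpha

variable {S : Scales L} {G : Type} [GaugeGroup G] [MeasurableSpace G] [HaarData G] (𝔊 : GroupModel G) (𝔠 : AlphaConsts L 𝔊.N)
  (X : ExternalInputsAC S G) (𝔖 : ∀ k, StepSeries S G ↥(lieC 𝔊) (nblkOf S 𝔠.lane.carrier k) k) (𝔄 : AlphaDataLTAC 𝔊 𝔠 X 𝔖)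
  (c : ∀ k, Hist S.P (k + 1) → GaugeField S.P (k + 1) G → ℕ → ℝ)

open Classical in
/-- **THE RANGE-HONEST CORE (α)-AC INPUTS OF STEP `k → k+1`, `k < K`, AT THE CUMULANT LETTER `c`** — `AlphaAC.StepAlphaAC k` row for row, EXCEPT: the five box∕potential
regularity rows `hμ hboxm hbox hVm hVB` and the tilted (3.24) pair `h324a`∕`h324c` are replaced by the ONE printed row `h324` ([B1] (3.24) as an output sandwich, error
constant `Ca + Cc`) at the letter `c k`; G3D-02 `hG` represents `Σ_{n≤n̄} c k h U n∕n!`; `hPYZ` reads the range-honest bundle's `Λc k hk`.  HYPOTHESES; nothing asserted.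
[cite: Balaban1985UV3, (23)–(33) pp.262–264 + (44) p.267 + (55)–(63) pp.269–272; Balaban1982Higgs1, (3.24) p.616] -/
structure StepAlphaEq324CoreLTAtAC (k : ℕ) (hk : k + 1 ≤ S.K) : Prop where
  /-- G3D-01 at the (25)-rate (R-ACT) -/
  chart : ∀ Y, ChartAnalyticityAsCited ((𝔖 k).Ψ Y) 𝔠.ρ
    (𝔠.C25 * S.gk k * Real.exp (-(𝔠.κ * (tsys 3 (nblkOf S 𝔠.lane.carrier k)).dj Y)))
  /-- (28) p. 263 -/
  bound28 : ∀ Y h U, ‖(𝔖 k).Bcfg Y h U‖ ≤ 𝔠.cB * (rFun 𝔠.r₀ (S.gk k) * S.gk k * pFun 𝔠.b₀ 𝔠.p₀ (S.gk k))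
  /-- (26) in the chart space, for the adjoint action -/
  inv26 : ∀ Y (U : G), ∀ b ∈ ball (0 : (𝔖 k).E) 𝔠.ρ, adjAct 𝔊 (P := S.P) k U b ∈ ball (0 : (𝔖 k).E) 𝔠.ρ →
    (𝔖 k).Ψ Y (adjAct 𝔊 (P := S.P) k U b) = (𝔖 k).Ψ Y b
  /-- G3D-06 -/
  far_le : FarTermsDecayAsCited (𝔖 k).far
    (fun Y => 𝔠.C25 * S.gk k * Real.exp (-(𝔠.κ * (tsys 3 (nblkOf S 𝔠.lane.carrier k)).dj Y)))
    𝔠.Cfar (S.gk k ^ 7 * (rFun 𝔠.r₀ (S.gk k) * pFun 𝔠.b₀ 𝔠.p₀ (S.gk k)) ^ 7)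
  /-- identification of `PY` with the retained jet -/
  hPY : ∀ h U, (𝔖 k).PY h U
    = ∑ Y ∈ (𝔖 k).loc (ΩblkOf 𝔠.lane.carrier.M₁ (rcolOf S 𝔠.lane.carrier) (nblkOf S 𝔠.lane.carrier k)) (rretOf S 𝔠.lane.carrier k) h,
        ((jet26 ((𝔖 k).Ψ Y) ((𝔖 k).Bcfg Y h U)).re - (𝔖 k).far Y h U)
  /-- identification of `PYZ` with the retained jet of the G3D-07 pieces AT THIS RUN STEP -/
  hPYZ : ∀ h U, (𝔖 k).PYZ h U
    = ∑ Y ∈ (𝔖 k).loc (ΩblkOf 𝔠.lane.carrier.M₁ (rcolOf S 𝔠.lane.carrier) (nblkOf S 𝔠.lane.carrier k)) (rretOf S 𝔠.lane.carrier k) h,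
        ((jet26 ((𝔄.Λc k hk).Ψ Y) ((𝔖 k).Bcfg Y h U)).re - (𝔄.Λc k hk).far Y h U)
  /-- G3D-04 -/
  norm35 : Norm35StepAsCited (piecesAC 𝔠.lane X 𝔖 k) 𝔠.c35 𝔠.a35 𝔠.cv 𝔠.cJ35
  /-- G3D-05 -/
  logZT : LogZTExtensiveAsCited (piecesAC 𝔠.lane X 𝔖 k) 𝔠.cT 𝔠.aT 𝔠.cn 𝔠.cJT
  /-- R-ACT: the graph carrier's activities are the chart activities -/
  hact : ∀ h Y U, ((𝔖 k).Gt h).activities.act Y U = (𝔖 k).act h Y U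
  /-- G3D-02, the graph terms representing `Σ_{n≤n̄} c k h U n ∕ n!` -/
  hG : ∀ h, GraphRep23AsCited ((𝔖 k).Gt h) (fun U => ∑ n ∈ Finset.Icc 1 𝔠.nbar, c k h U n / (n.factorial : ℝ))
    (𝔄.C₂₃ k) (𝔄.c₂₃ k) (𝔄.M₂₃ k) (𝔄.δ₀ k)
  /-- [B1] (3.24) AS PRINTED for the step's fluctuation integral over the small-field box, with the cumulants `c k h U` -/
  h324 : ∀ h (U : GaugeField S.P (k + 1) G),
    Eq324 (∫ ω in (𝔖 k).box h, Real.exp ((𝔖 k).𝒱 h U ω) ∂(𝔖 k).μ) (c k h U) 𝔠.nbar (𝔠.Ca + 𝔠.Cc)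
      ((L : ℝ) ^ k * S.g0sq) (3 + 𝔠.κ₀) (S.sites k)
  /-- (44) p. 267 on the previous-scale terms of the data -/
  h44 : ∀ (h : Hist S.P (k + 1)) (U : GaugeField S.P (k + 1) G), ∀ j ∈ Finset.Icc 1 k,
    Bound44 (oldGeom S.P k j) (fun y n c' => (𝔖 k).oldVal h U j y n c') 𝔠.κ₁ (𝔠.M₁ : ℝ) (ell S.P k j) (L : ℝ) 𝔠.B₃
      (S.gk k) (pFun 𝔠.b₀ 𝔠.p₀ (S.gk k)) 𝔠.C44
  /-- the degree floor «n ≥ 2» of (43) -/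
  hfloor : ∀ (h : Hist S.P (k + 1)) (U : GaugeField S.P (k + 1) G), ∀ j ∈ Finset.Icc 1 k,
    ∀ (y : Site S.P j) (n : ℕ) (c' : Fin n → PBond S.P j), (𝔖 k).oldVal h U j y n c' ≠ 0 → 2 ≤ n
  /-- EXTERNAL-input property ([7] Thm 1): `U_k(·, h)` measurable -/
  hU : ∀ h : Hist S.P k, Measurable (X.UkH k h)
  /-- `Pint k h` of the AC tower measurable … -/
  hPm : ∀ h : Hist S.P k, Measurable ((inputOfAC 𝔠.lane X 𝔖).Pint k h)
  /-- … and bounded above -/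
  hPb : ∀ (h : Hist S.P k) (U : GaugeField S.P k G), (inputOfAC 𝔠.lane X 𝔖).Pint k h U ≤ 𝔄.cP k
  /-- RESIDUAL R3D-01 (p4), transported form at the AC pieces -/
  fibre49 : ∀ h' : Hist S.P (k + 1), Fibre49AC X 𝔠.lane.carrier 𝔖 (fun _ => True) k (piecesWAC 𝔠.lane X 𝔖 k) h'
  /-- RESIDUAL R3D-02 (p4), transported form at the AC pieces -/
  fibre57Low : Fibre57LowAC X 𝔠.lane.carrier 𝔖 (fun _ => True) k (piecesWAC 𝔠.lane X 𝔖 k)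

/-- **THE RANGE-HONEST CORE (α)-AC CLAUSE OF ONE LATTICE APPROXIMATION AT THE CUMULANT LETTER `c`**: the step inputs at every run step `k < K` + the two B25 displays
(67)∘LF and (68) on the lifted composite minimizers (`AlphaAC.RunAlphaAC`'s, verbatim).  HYPOTHESES. [cite: Balaban1985UV3, (67)–(68) p.273 + pp.273–274] -/
structure RunAlphaEq324CoreLTAtAC : Prop where
  /-- the core step inputs at the letter, keyed on the run step -/
  steps : ∀ k (hk : k + 1 ≤ S.K), StepAlphaEq324CoreLTAtAC 𝔊 𝔠 X 𝔖 𝔄 c k hk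
  /-- (67) ∘ the large-field characteristic function of the history, on the averaged lifted minimizers -/
  hLF67 : ∀ k, k ≤ S.K → ∀ (h : Hist S.P k), Hist.Admissible 𝔠.lane.carrier.M₁ (rcolOf S 𝔠.lane.carrier) k h →
    ∀ (U : GaugeField S.P k G), ∀ e ∈ Hist.disc h, S.gk e.1 * pFun 𝔠.lane.carrier.b₀ 𝔠.lane.carrier.p₀ (S.gk e.1) ≤
      ‖((hol (avgIter L (liftCfg 𝔊 (X.UkH k h U)) e.1) (codeZ e) (plaqWord e.2.2.1 e.2.2.2) :
          (Matrix (Fin 𝔊.N) (Fin 𝔊.N) ℂ)ˣ) : Matrix (Fin 𝔊.N) (Fin 𝔊.N) ℂ) - 1‖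
  /-- (68) on the lifted minimizers -/
  h68 : ∀ k, k ≤ S.K → ∀ (h : Hist S.P k), Hist.Admissible 𝔠.lane.carrier.M₁ (rcolOf S 𝔠.lane.carrier) k h →
    ∀ (U : GaugeField S.P k G), ∀ e ∈ Hist.disc h,
      pdevOn (loK L e.1 (codeZ e)) (plaqHiK L e.1 (codeZ e) e.2.2.1 e.2.2.2) (liftCfg 𝔊 (X.UkH k h U)) <
        𝔠.C68 * (S.gk e.1 * pFun 𝔠.lane.carrier.b₀ 𝔠.lane.carrier.p₀ (S.gk e.1)) * (((L : ℝ) ^ e.1)⁻¹) ^ 2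

end Alpha

/-! ## §4 The AC clause AS LANDED implies the edition at the lane's χ-letter -/
section FromAC

variable {S : Scales L} {G : Type} [GaugeGroup G] [MeasurableSpace G] [HaarData G] {𝔊 : GroupModel G} {𝔠 : AlphaConsts L 𝔊.N}
  {X : ExternalInputsAC S G} {𝔖 : ∀ k, StepSeries S G ↥(lieC 𝔊) (nblkOf S 𝔠.lane.carrier k) k}

/-- **THE AC STEP LIST AS LANDED IMPLIES THE EDITED ONE AT THE LANE'S χ-LETTER `(𝔖 k).cum`** over the restricted bundle: rows (a) `h324a` + (c) `h324c` (+ the five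
regularity rows) give the printed sandwich `h324` with constant `Ca + 0 + Cc = Ca + Cc` by the lane's Taylor–Lagrange theorem `Eq324Chi.eq324_indicator_of_measurableSet`
(the re-expansion input (b) vanishing since the printed cumulants ARE the data's `(𝔖 k).cum`, R-324); every other row is carried over.  No converse: the tilted
cgf-derivative bound is strictly stronger than the output sandwich. [cite: Balaban1982Higgs1, (3.24) p.616; Balaban1985UV3, (58) p.270] -/
theorem stepCoreLTAtAC_of_stepAlphaAC {𝔄 : AlphaDataAC 𝔊 𝔠 X 𝔖} {k : ℕ} (hk : k + 1 ≤ S.K) (A : StepAlphaAC 𝔊 𝔠 X 𝔖 𝔄 k) :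
    StepAlphaEq324CoreLTAtAC 𝔊 𝔠 X 𝔖 (restrictLTAC 𝔄) (fun k => (𝔖 k).cum) k hk where
  chart := A.chart
  bound28 := A.bound28
  inv26 := A.inv26
  far_le := A.far_le
  hPY := A.hPY
  hPYZ := A.hPYZ
  norm35 := A.norm35
  logZT := A.logZT
  hact := A.hact
  hG := A.hG
  h324 h U := by
    haveI := A.hμ
    have h := eq324_indicator_of_measurableSet (C₂ := 0) (𝔖 k).μ (A.hboxm h) (A.hbox h) (A.hVm h U) (A.hVB h U)
      𝔠.nbar ((𝔖 k).cum h U) (A.h324a h U) (by simp [StepSeries.cum]) (A.h324c h U)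
    simpa only [add_zero] using h
  h44 := A.h44
  hfloor := A.hfloor
  hU := A.hU
  hPm := A.hPm
  hPb := A.hPb
  fibre49 := A.fibre49
  fibre57Low := A.fibre57Low

/-- ★ **THE (α)-AC CLAUSE AS LANDED (`AlphaAC.RunAlphaAC`, the antecedent of dag-n08-w1's road (R4‴)) IMPLIES THE RANGE-HONEST CORE EDITION AT THE LANE'S χ-LETTER** over
`restrictLTAC` — so every inhabitant of (R4‴)'s antecedent inhabits this clause (A6: the edition is a WEAKENING, not a new obligation).
[cite: Balaban1985UV3, (67)–(68) p.273 (bookkeeping); Balaban1982Higgs1, (3.24) p.616] -/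
theorem coreLTAtAC_cum_of_runAlphaAC {𝔄 : AlphaDataAC 𝔊 𝔠 X 𝔖} (R : RunAlphaAC 𝔊 𝔠 X 𝔖 𝔄) :
    RunAlphaEq324CoreLTAtAC 𝔊 𝔠 X 𝔖 (restrictLTAC 𝔄) (fun k => (𝔖 k).cum) where
  steps k hk := stepCoreLTAtAC_of_stepAlphaAC hk (R.steps k hk)
  hLF67 := R.hLF67
  h68 := R.h68

end FromAC

end Summit.QuantumFields.YangMills.Theorems.BalabanUVNodesN08AlphaEq324RowAC

end
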